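import Literature.AlgebraicGeometry.Motives.ProjectiveSpaceFieldPoints
import HarnessLib

/-!
# Field-valued points of projective space: homogeneous coordinates exist and are unique up to `Lˣ`

Sequel to `Motives/ProjectiveSpaceFieldPoints`. For fields `k ⊆ L` (`L` a `k`-algebra) and the
`L`-points of `ℙⁿ_k` over `k`:

* `ProjectiveSpace.exists_eq_pointOfVec`: every `L`-point `P : Spec L → ℙⁿ_k` is `pointOfVec k z hz`
  for some `z ≠ 0` — `P` lands in some standard chart `D₊(xᵢ) = Spec k[x]_{(xᵢ)}` (Hartshorne II
  Prop. 2.5), i.e. is `Spec` of a `k`-algebra map `e : k[x]_{(xᵢ)} → L`, and `e` is evaluation at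
  `z = (e(xⱼ/xᵢ))ⱼ` (`algHom_awayMk_eq_aeval`: `k[x]_{(xᵢ)}` is generated by the `xⱼ/xᵢ`,
  Hartshorne I Thm. 3.4);
* `ProjectiveSpace.pointOfVec_eq_pointOfVec_iff`: `pointOfVec k z _ = pointOfVec k z' _ ↔ z' = c • z`
  for some `c ≠ 0` (normalise `zᵢ = 1` on a common chart and compare the algebra maps; the chart
  inclusion is a monomorphism).

Together: `ℙⁿ_k(L) = (Lⁿ⁺¹ ∖ 0)/Lˣ` (Hartshorne II Ex. 2.14, Thm. 7.1 for `X = Spec L`;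
Görtz–Wedhorn I (13.8)).

## References

* R. Hartshorne, *Algebraic Geometry*, GTM 52 (1977): I Thm. 3.4, II Prop. 2.5, II Ex. 2.14,
  II Thm. 7.1. [Hartshorne1977]
* U. Görtz, T. Wedhorn, *Algebraic Geometry I*, 2nd ed. (2020): (13.8), p. 484. [GortzWedhorn2020]
-/

noncomputable section

open CategoryTheory AlgebraicGeometry HomogeneousLocalization MvPolynomial

universe u

namespace Literature.AlgebraicGeometry.Motives

namespace ProjectiveSpace

variable {k : Type u} [Field k] {n : ℕ} {L : Type u} [Field L] [Algebra k L]

attribute [local instance] MvPolynomial.gradedAlgebra ProjBaseChange.algebraBase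

local notation "𝒜" => MvPolynomial.homogeneousSubmodule (Fin (n + 1)) k

/-! ### Algebra maps out of `k[x]_{(xᵢ)}` are evaluations -/

section Coord

variable (i : Fin (n + 1))

/-- The coordinate `xⱼ/xᵢ ∈ k[x₀,…,xₙ]_{(xᵢ)}`. [folklore] -/
def coord (j : Fin (n + 1)) : Away 𝒜 (X i) :=
  Away.mk 𝒜 (X_mem i) 1 (X j) (by simpa using X_mem (R := k) j)

/-- `xᵢ/xᵢ = 1`. [folklore] -/
@[simp]
theorem coord_self : coord (k := k) i i = 1 := by
  refine val_injective _ ?_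
  rw [coord, Away.val_mk, val_one]
  convert Localization.mk_self
    (⟨X i ^ 1, pow_mem (Submonoid.mem_powers _) 1⟩ : Submonoid.powers (X i : MvPolynomial _ k))
  exact (pow_one _).symm

/-- For `j = i.succAbove j'`, `xⱼ/xᵢ` is the chart generator `chartGen k i j'` of
`Motives/VarietiesProjectiveSpaceProofs` (`rfl`). [folklore] -/
@[simp]
theorem coord_succAbove (j : Fin n) : coord (k := k) i (i.succAbove j) = chartGen k i j := rfl

/-- **`k[x]_{(xᵢ)}` is generated by the `xⱼ/xᵢ`**: a `k`-algebra map `e : k[x]_{(xᵢ)} → L` takes on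
`g/xᵢᵐ` the value `g(e(x₀/xᵢ), …, e(xₙ/xᵢ))` (through the chart isomorphism
`k[x]_{(xᵢ)} ≅ k[y₁,…,yₙ]` of `Motives/VarietiesProjectiveSpaceProofs`, Hartshorne I Thm. 3.4).
[cite: Hartshorne1977, I Thm. 3.4 (proof)] -/
theorem algHom_awayMk_eq_aeval (e : Away 𝒜 (X i) →ₐ[k] L) {m : ℕ}
    (g : MvPolynomial (Fin (n + 1)) k) (hg : g ∈ 𝒜 (m • 1)) :
    e (Away.mk 𝒜 (X_mem i) m g hg) = aeval (fun j => e (coord i j)) g := by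
  rw [← toChart_ofChart i (Away.mk 𝒜 (X_mem i) m g hg)]
  change e (toChart k i (ofChartRingHom k i _)) = _
  rw [ofChartRingHom_mk, toChart, dehomogenize, ← AlgHom.comp_apply, ← AlgHom.comp_apply,
    comp_aeval, comp_aeval]
  refine DFunLike.congr_fun (congrArg aeval (funext fun s => ?_)) g
  rcases Fin.eq_self_or_eq_succAbove i s with rfl | ⟨j, rfl⟩
  · simp
  · simp

end Coord

/-! ### Every `L`-point has homogeneous coordinates -/

section Surjective

variable (i : Fin (n + 1))

/-- An `L`-point of the chart `Spec k[x]_{(xᵢ)}` given by a `k`-algebra map `e` is the evaluation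
point at `z = (e(xⱼ/xᵢ))ⱼ` (so `zᵢ = 1`). [folklore] -/
theorem awayEval_coord_eq (e : Away 𝒜 (X i) →ₐ[k] L) :
    awayEval (t := X i) (fun j => e (coord i j))
      (by rw [aeval_X, coord_self, map_one]; exact one_ne_zero) = e := by
  refine AlgHom.ext fun q => ?_
  obtain ⟨m, g, hg, rfl⟩ := Away.mk_surjective 𝒜 (X_mem i) q
  rw [awayEval_mk _ _ (X_mem i), algHom_awayMk_eq_aeval, aeval_X, coord_self, map_one, one_pow,
    div_one]

/-- `Spec L` has a single point: the range of a morphism out of it is the image of the closed point.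
[folklore] -/
theorem range_eq_singleton {Y : Scheme.{u}} (f : Spec (.of L) ⟶ Y) :
    Set.range f = {f (IsLocalRing.closedPoint L)} := by
  ext y
  simp only [Set.mem_range, Set.mem_singleton_iff]
  constructor
  · rintro ⟨x, rfl⟩
    rw [Subsingleton.elim x (IsLocalRing.closedPoint L)]
  · rintro rfl
    exact ⟨_, rfl⟩

/-- **An `L`-point of `ℙⁿ_k` lying in `D₊(xᵢ)` has homogeneous coordinates with `zᵢ = 1`**: it
factors through the open immersion `Spec k[x]_{(xᵢ)} → ℙⁿ_k` (Mathlib `IsOpenImmersion.lift`), the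
factorisation is `Spec` of a `k`-algebra map (`AlgPoints.ofAlgHom_surjective`), which is an
evaluation (`awayEval_coord_eq`). Hartshorne II Prop. 2.5, Ex. 2.14. [folklore] -/
theorem exists_eq_chartPoint_of_mem (P : AlgPoints (projectiveSpace n k) L)
    (hP : P.pt ∈ Proj.basicOpen 𝒜 (X i)) :
    ∃ (z : Fin (n + 1) → L) (hz : z i = 1),
      P = chartPoint (X_mem i) one_pos z (by rw [aeval_X, hz]; exact one_ne_zero) := by
  -- factor `P` through the chart
  have hrange : Set.range P.left ⊆ Set.range (awayChartι (n := n) (X_mem (R := k) i) one_pos).left := by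
    rintro _ ⟨x, rfl⟩
    have hx : x = IsLocalRing.closedPoint L :=
      Subsingleton.elim (α := PrimeSpectrum L) x (IsLocalRing.closedPoint L)
    subst hx
    rw [← Scheme.Hom.coe_opensRange, opensRange_awayChartι_left]
    exact hP
  let l := IsOpenImmersion.lift (awayChartι (n := n) (X_mem (R := k) i) one_pos).left P.left hrange
  have hl : l ≫ (awayChartι (n := n) (X_mem (R := k) i) one_pos).left = P.left :=
    IsOpenImmersion.lift_fac _ _ hrange
  -- as an `L`-point of the chart scheme over `k`
  let Q : AlgPoints (specOver k (Away 𝒜 (X i))) L := AlgPoints.mk l (by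
    have h := Over.w P
    rw [← hl, Category.assoc] at h
    rw [← Over.w (awayChartι (n := n) (X_mem (R := k) i) one_pos)]
    exact h)
  have hQ : AlgPoints.map (awayChartι (X_mem i) one_pos) Q = P := by
    ext : 1
    exact hl
  obtain ⟨e, he⟩ := AlgPoints.ofAlgHom_surjective Q
  refine ⟨fun j => e (coord i j), by simp, ?_⟩
  rw [← hQ, ← he, chartPoint, awayEval_coord_eq]

/-- **Every `L`-point of `ℙⁿ_k` has homogeneous coordinates**: `P = pointOfVec k z hz` for some
`z ≠ 0` (the `D₊(xᵢ)` cover `ℙⁿ_k`). Hartshorne II Ex. 2.14 / Thm. 7.1; Görtz–Wedhorn I (13.8).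
[folklore] -/
theorem exists_eq_pointOfVec (P : AlgPoints (projectiveSpace n k) L) :
    ∃ (z : Fin (n + 1) → L) (hz : z ≠ 0), P = pointOfVec k z hz := by
  obtain ⟨i, y, hy⟩ := (chartCover n k).exists_eq P.pt
  have hP : P.pt ∈ Proj.basicOpen 𝒜 (X i) := by
    rw [← Proj.opensRange_awayι 𝒜 (X i : MvPolynomial (Fin (n + 1)) k) (X_mem i) zero_lt_one]
    exact ⟨y, hy⟩
  obtain ⟨z, hzi, rfl⟩ := exists_eq_chartPoint_of_mem i P hP
  have hz : z ≠ 0 := fun h => one_ne_zero (hzi.symm.trans (by rw [h]; rfl))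
  exact ⟨z, hz, (pointOfVec_eq_chartPoint z hz (X_mem i) one_pos _).symm⟩

end Surjective

/-! ### Homogeneous coordinates are unique up to a scalar -/

section Injective

/-- Two `L`-points of the chart `Spec k[x]_{(t)}` with the same image in `ℙⁿ_k` have the same
evaluation map (the chart inclusion is a monomorphism and `Spec` is faithful). [folklore] -/
theorem awayEval_eq_of_chartPoint_eq {t : MvPolynomial (Fin (n + 1)) k} {d : ℕ}
    (ht : t ∈ 𝒜 d) (hd : 0 < d) {z z' : Fin (n + 1) → L} (hz : aeval z t ≠ 0)
    (hz' : aeval z' t ≠ 0) (h : chartPoint ht hd z hz = chartPoint ht hd z' hz') :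
    awayEval z hz = awayEval z' hz' := by
  have h1 := congrArg (fun P : AlgPoints (projectiveSpace n k) L => P.left) h
  simp only [chartPoint_left] at h1
  have h2 := Spec.map_injective ((cancel_mono (Proj.awayι 𝒜 t ht hd)).mp h1)
  have h3 := congrArg CommRingCat.Hom.hom h2
  simp only [CommRingCat.hom_ofHom] at h3
  exact AlgHom.ext fun q => RingHom.congr_fun h3 q

/-- **Homogeneous coordinates are unique up to `Lˣ`**: `pointOfVec k z _ = pointOfVec k z' _` iff
`z' = c • z` for some `c ≠ 0`. Hartshorne II Ex. 2.14; Görtz–Wedhorn I (13.8). [folklore] -/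
theorem pointOfVec_eq_pointOfVec_iff (z z' : Fin (n + 1) → L) (hz : z ≠ 0) (hz' : z' ≠ 0) :
    pointOfVec k z hz = pointOfVec k z' hz' ↔ ∃ c : L, c ≠ 0 ∧ z' = c • z := by
  constructor
  · intro h
    -- a common chart `D₊(xᵢ)`
    set i := firstNe z hz with hi_def
    have hi : z i ≠ 0 := apply_firstNe_ne_zero z hz
    have hi' : z' i ≠ 0 := by
      rw [← pt_pointOfVec_mem_basicOpen_X_iff (k := k) z' hz' i, ← h]
      exact (pt_pointOfVec_mem_basicOpen_X_iff z hz i).mpr hi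
    -- normalise the `i`-th coordinates to `1`
    set w : Fin (n + 1) → L := (z i)⁻¹ • z with hw_def
    set w' : Fin (n + 1) → L := (z' i)⁻¹ • z' with hw'_def
    have hw0 : w ≠ 0 := smul_ne_zero (inv_ne_zero hi) hz
    have hw'0 : w' ≠ 0 := smul_ne_zero (inv_ne_zero hi') hz'
    have hwi : w i = 1 := by simp [hw_def, hi]
    have hw'i : w' i = 1 := by simp [hw'_def, hi']
    have hwt : aeval w (X i : MvPolynomial (Fin (n + 1)) k) ≠ 0 := by
      rw [aeval_X, hwi]; exact one_ne_zero
    have hw't : aeval w' (X i : MvPolynomial (Fin (n + 1)) k) ≠ 0 := by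
      rw [aeval_X, hw'i]; exact one_ne_zero
    have hww' : chartPoint (X_mem i) one_pos w hwt = chartPoint (X_mem i) one_pos w' hw't := by
      rw [← pointOfVec_eq_chartPoint w hw0, ← pointOfVec_eq_chartPoint w' hw'0]
      exact ((pointOfVec_smul z hz _ (inv_ne_zero hi) hw0).trans h).trans
        (pointOfVec_smul z' hz' _ (inv_ne_zero hi') hw'0).symm
    have he := awayEval_eq_of_chartPoint_eq (X_mem i) one_pos hwt hw't hww'
    -- compare coordinates
    have hcoord : ∀ j, w j = w' j := fun j => by
      have := congrArg (fun e : Away 𝒜 (X i) →ₐ[k] L => e (coord i j)) he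
      simp only [coord, awayEval_mk _ _ (X_mem i), aeval_X, hwi, hw'i, one_pow, div_one] at this
      exact this
    refine ⟨z' i * (z i)⁻¹, mul_ne_zero hi' (inv_ne_zero hi), ?_⟩
    funext j
    have hj := hcoord j
    simp only [hw_def, hw'_def, Pi.smul_apply, smul_eq_mul] at hj
    rw [Pi.smul_apply, smul_eq_mul]
    calc z' j = z' i * ((z' i)⁻¹ * z' j) := by rw [← mul_assoc, mul_inv_cancel₀ hi', one_mul]
      _ = z' i * ((z i)⁻¹ * z j) := by rw [hj]
      _ = z' i * (z i)⁻¹ * z j := by rw [mul_assoc]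
  · rintro ⟨c, hc, rfl⟩
    exact (pointOfVec_smul z hz c hc _).symm

end Injective

end ProjectiveSpace

end Literature.AlgebraicGeometry.Motives
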